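import Literature.Probability.LatticeModels.SahiThirdOrderCorrelation
import Summits.CriticalPhenomena.PercolationContinuityZ3.Theorems.PercNearOneGluingNoHeavyLowerTailSahiC3CubeThreeFKG
import Summits.CriticalPhenomena.PercolationContinuityZ3.Theorems.PercNearOneGluingNoHeavyLowerTailSahiC3CubeFourFKG
import Mathlib.Data.Finset.Prod
import Mathlib.Tactic.Linarith
import Mathlib.Tactic.Ring
import HarnessLib
import HarnessLib.Audit

/-!
# `NoHeavyLowerTail` (crux stmt-CriticalPhenomena-4575), Sahi programme P4: Sahi's `C₃` is CLOSED UNDER INDEPENDENT PRODUCTS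
# of set-triples ("rectangles"), with an exact identity

Support file (cell `prim-l12`, seat P4, generation 31; `--supports stmt-CriticalPhenomena-4575`).  No named facts, no sorries;
standard axioms; def-free.

For probability weights `ν_B` on `B` and `ν_Q` on `Q`, the product weight `w(b,t) = ν_B(b)ν_Q(t)` on `B × Q`, and RECTANGLES
`U = U_B ×ˢ U_Q`, `A = A_B ×ˢ A_Q`, `C = C_B ×ˢ C_Q`, Sahi's third functional satisfies the exact identity (`latticeE3_rect_eq`)
  `E₃(U,A,C) = t·E₃^Q(U_Q,A_Q,C_Q) + u′a′c′·E₃^B(U_B,A_B,C_B) + u′(r′ − a′c′)(t − u r) + a′(q′ − u′c′)(t − a q) + c′(p′ − u′a′)(t − c p)`,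
where `u,a,c,p,q,r,t` are the `ν_B`-masses of `U_B, A_B, C_B, U_B∩A_B, U_B∩C_B, A_B∩C_B, U_B∩A_B∩C_B` and primes denote the `ν_Q`-masses
of the `Q`-factors.  Every bracket is a Harris slack, so (`latticeE3_rect_nonneg`) **`C₃` for the two factor triples plus Harris on each
block gives `C₃` for the rectangle triple**; in particular for FKG probability weights on two finite distributive lattices with up-set
factors (`latticeE3_rect_nonneg_of_fkg`, conditional on the two factor instances of `C₃`), and UNCONDITIONALLY when the blocks are
`{0,1}³` / `{0,1}⁴` where `C₃` is a tree theorem (`latticeE3_rect_nonneg_cube_four_four`: every pair of FKG block weights on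
`{0,1}⁴ × {0,1}⁴`, all rectangle triples — an 8-variable family not covered by the cube censuses).  At order 3 this generalises, from
chains to arbitrary blocks satisfying `C₃`, the block structure of Lieb–Sahi's rectangle theorem [LiebSahi2021, Thm. 3.5]
(`Literature…Rectangles`, where the blocks are chains and rectangles are principal); it is the "all three slots factor" case of the
tensorisation identity `…SahiE3Tensor.latticeE3_tensor` (gen 31), in which the cross covariances become products of Harris slacks. [this work]
-/

namespace Summit.CriticalPhenomena.PercolationContinuityZ3.Theorems.SahiE3ProductClosure

open Finset Literature.Probability.LatticeModels
open scoped BigOperators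

variable {B Q : Type*} [Fintype B] [DecidableEq B] [Fintype Q] [DecidableEq Q]

omit [Fintype B] [DecidableEq B] [Fintype Q] [DecidableEq Q] in
/-- The mass of a rectangle under a product weight is the product of the factor masses. [folklore] -/
theorem mass_rect (νB : B → ℝ) (νQ : Q → ℝ) (w : B × Q → ℝ) (hw : ∀ x, w x = νB x.1 * νQ x.2)
    (XB : Finset B) (XQ : Finset Q) : mass w (XB ×ˢ XQ) = mass νB XB * mass νQ XQ := by
  unfold mass
  rw [Finset.sum_product, Finset.sum_mul_sum]
  exact Finset.sum_congr rfl fun b _ => Finset.sum_congr rfl fun t _ => hw (b, t)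

/-- **The product identity for `E₃` on rectangles** (see the module docstring; both factor weights of mass `1`). [this work] -/
theorem latticeE3_rect_eq (νB : B → ℝ) (νQ : Q → ℝ) (hB1 : ∑ b, νB b = 1) (hQ1 : ∑ t, νQ t = 1)
    (w : B × Q → ℝ) (hw : ∀ x, w x = νB x.1 * νQ x.2) (UB AB CB : Finset B) (UQ AQ CQ : Finset Q) :
    latticeE3 w (UB ×ˢ UQ) (AB ×ˢ AQ) (CB ×ˢ CQ) =
      mass νB (UB ∩ AB ∩ CB) * latticeE3 νQ UQ AQ CQ
      + mass νQ UQ * mass νQ AQ * mass νQ CQ * latticeE3 νB UB AB CB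
      + mass νQ UQ * (mass νQ (AQ ∩ CQ) - mass νQ AQ * mass νQ CQ) *
          (mass νB (UB ∩ AB ∩ CB) - mass νB UB * mass νB (AB ∩ CB))
      + mass νQ AQ * (mass νQ (UQ ∩ CQ) - mass νQ UQ * mass νQ CQ) *
          (mass νB (UB ∩ AB ∩ CB) - mass νB AB * mass νB (UB ∩ CB))
      + mass νQ CQ * (mass νQ (UQ ∩ AQ) - mass νQ UQ * mass νQ AQ) *
          (mass νB (UB ∩ AB ∩ CB) - mass νB CB * mass νB (UB ∩ AB)) := by
  have hZB : mass νB univ = 1 := by rw [mass_univ]; exact hB1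
  have hZQ : mass νQ univ = 1 := by rw [mass_univ]; exact hQ1
  have hZ : mass w univ = 1 := by
    rw [← Finset.univ_product_univ, mass_rect νB νQ w hw, hZB, hZQ, one_mul]
  have i1 : (UB ×ˢ UQ) ∩ (AB ×ˢ AQ) ∩ (CB ×ˢ CQ) = (UB ∩ AB ∩ CB) ×ˢ (UQ ∩ AQ ∩ CQ) := by
    rw [Finset.product_inter_product, Finset.product_inter_product]
  have i2 : (AB ×ˢ AQ) ∩ (CB ×ˢ CQ) = (AB ∩ CB) ×ˢ (AQ ∩ CQ) := Finset.product_inter_product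
  have i3 : (UB ×ˢ UQ) ∩ (CB ×ˢ CQ) = (UB ∩ CB) ×ˢ (UQ ∩ CQ) := Finset.product_inter_product
  have i4 : (UB ×ˢ UQ) ∩ (AB ×ˢ AQ) = (UB ∩ AB) ×ˢ (UQ ∩ AQ) := Finset.product_inter_product
  unfold latticeE3
  rw [i1, i2, i3, i4, hZ, hZB, hZQ]
  simp only [mass_rect νB νQ w hw]
  ring

/-- **`C₃` is closed under independent products of triples.**  Probability weights `ν_B, ν_Q ≥ 0`; the factor triples satisfy
`C₃` (`0 ≤ latticeE3 ν_B U_B A_B C_B`, `0 ≤ latticeE3 ν_Q U_Q A_Q C_Q`) and the six Harris instances (each set against the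
intersection of the other two on `B`; the three pairs on `Q`); then the rectangle triple satisfies `C₃`. [this work] -/
theorem latticeE3_rect_nonneg (νB : B → ℝ) (νQ : Q → ℝ) (hB0 : ∀ b, 0 ≤ νB b) (hQ0 : ∀ t, 0 ≤ νQ t)
    (hB1 : ∑ b, νB b = 1) (hQ1 : ∑ t, νQ t = 1) (w : B × Q → ℝ) (hw : ∀ x, w x = νB x.1 * νQ x.2)
    (UB AB CB : Finset B) (UQ AQ CQ : Finset Q)
    (hB3 : 0 ≤ latticeE3 νB UB AB CB) (hQ3 : 0 ≤ latticeE3 νQ UQ AQ CQ)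
    (hBu : mass νB UB * mass νB (AB ∩ CB) ≤ mass νB (UB ∩ AB ∩ CB))
    (hBa : mass νB AB * mass νB (UB ∩ CB) ≤ mass νB (UB ∩ AB ∩ CB))
    (hBc : mass νB CB * mass νB (UB ∩ AB) ≤ mass νB (UB ∩ AB ∩ CB))
    (hQac : mass νQ AQ * mass νQ CQ ≤ mass νQ (AQ ∩ CQ)) (hQuc : mass νQ UQ * mass νQ CQ ≤ mass νQ (UQ ∩ CQ))
    (hQua : mass νQ UQ * mass νQ AQ ≤ mass νQ (UQ ∩ AQ)) :
    0 ≤ latticeE3 w (UB ×ˢ UQ) (AB ×ˢ AQ) (CB ×ˢ CQ) := by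
  rw [latticeE3_rect_eq νB νQ hB1 hQ1 w hw]
  have hB0' : 0 ≤ νB := fun b => hB0 b
  have hQ0' : 0 ≤ νQ := fun t => hQ0 t
  have t1 : 0 ≤ mass νB (UB ∩ AB ∩ CB) * latticeE3 νQ UQ AQ CQ := mul_nonneg (mass_nonneg hB0' _) hQ3
  have t2 : 0 ≤ mass νQ UQ * mass νQ AQ * mass νQ CQ * latticeE3 νB UB AB CB :=
    mul_nonneg (mul_nonneg (mul_nonneg (mass_nonneg hQ0' _) (mass_nonneg hQ0' _)) (mass_nonneg hQ0' _)) hB3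
  have t3 : 0 ≤ mass νQ UQ * (mass νQ (AQ ∩ CQ) - mass νQ AQ * mass νQ CQ) *
      (mass νB (UB ∩ AB ∩ CB) - mass νB UB * mass νB (AB ∩ CB)) :=
    mul_nonneg (mul_nonneg (mass_nonneg hQ0' _) (sub_nonneg.2 hQac)) (sub_nonneg.2 hBu)
  have t4 : 0 ≤ mass νQ AQ * (mass νQ (UQ ∩ CQ) - mass νQ UQ * mass νQ CQ) *
      (mass νB (UB ∩ AB ∩ CB) - mass νB AB * mass νB (UB ∩ CB)) :=
    mul_nonneg (mul_nonneg (mass_nonneg hQ0' _) (sub_nonneg.2 hQuc)) (sub_nonneg.2 hBa)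
  have t5 : 0 ≤ mass νQ CQ * (mass νQ (UQ ∩ AQ) - mass νQ UQ * mass νQ AQ) *
      (mass νB (UB ∩ AB ∩ CB) - mass νB CB * mass νB (UB ∩ AB)) :=
    mul_nonneg (mul_nonneg (mass_nonneg hQ0' _) (sub_nonneg.2 hQua)) (sub_nonneg.2 hBc)
  linarith

/-- **FKG form.**  `B, Q` finite distributive lattices with FKG probability weights, all six factors up-sets; the Harris instances are
Mathlib's four-functions theorem (`Literature…fkg_upperSet_mass`), so the rectangle triple satisfies `C₃` as soon as the two factor
triples do. [this work] -/
theorem latticeE3_rect_nonneg_of_fkg {L M : Type*} [DistribLattice L] [Fintype L] [DecidableEq L] [DistribLattice M] [Fintype M]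
    [DecidableEq M] (νB : L → ℝ) (νQ : M → ℝ) (hB0 : ∀ b, 0 ≤ νB b) (hQ0 : ∀ t, 0 ≤ νQ t)
    (hBf : ∀ a b, νB a * νB b ≤ νB (a ⊓ b) * νB (a ⊔ b)) (hQf : ∀ a b, νQ a * νQ b ≤ νQ (a ⊓ b) * νQ (a ⊔ b))
    (hB1 : ∑ b, νB b = 1) (hQ1 : ∑ t, νQ t = 1) (w : L × M → ℝ) (hw : ∀ x, w x = νB x.1 * νQ x.2)
    (UB AB CB : Finset L) (UQ AQ CQ : Finset M) (hUB : IsUpperSet (UB : Set L)) (hAB : IsUpperSet (AB : Set L))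
    (hCB : IsUpperSet (CB : Set L)) (hUQ : IsUpperSet (UQ : Set M)) (hAQ : IsUpperSet (AQ : Set M))
    (hCQ : IsUpperSet (CQ : Set M)) (hB3 : 0 ≤ latticeE3 νB UB AB CB) (hQ3 : 0 ≤ latticeE3 νQ UQ AQ CQ) :
    0 ≤ latticeE3 w (UB ×ˢ UQ) (AB ×ˢ AQ) (CB ×ˢ CQ) := by
  have hB0' : 0 ≤ νB := fun b => hB0 b
  have hQ0' : 0 ≤ νQ := fun t => hQ0 t
  have hZB : mass νB univ = 1 := by rw [mass_univ]; exact hB1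
  have hZQ : mass νQ univ = 1 := by rw [mass_univ]; exact hQ1
  have up2 : ∀ {X Y : Finset L}, IsUpperSet (X : Set L) → IsUpperSet (Y : Set L) → IsUpperSet ((X ∩ Y : Finset L) : Set L) :=
    fun hX hY => by rw [Finset.coe_inter]; exact hX.inter hY
  have hBu := fkg_upperSet_mass hB0' hBf hUB (up2 hAB hCB)
  have hBa := fkg_upperSet_mass hB0' hBf hAB (up2 hUB hCB)
  have hBc := fkg_upperSet_mass hB0' hBf hCB (up2 hUB hAB)
  have hQac := fkg_upperSet_mass hQ0' hQf hAQ hCQ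
  have hQuc := fkg_upperSet_mass hQ0' hQf hUQ hCQ
  have hQua := fkg_upperSet_mass hQ0' hQf hUQ hAQ
  rw [hZB, one_mul] at hBu hBa hBc
  rw [hZQ, one_mul] at hQac hQuc hQua
  have e1 : UB ∩ (AB ∩ CB) = UB ∩ AB ∩ CB := (Finset.inter_assoc UB AB CB).symm
  have e2 : AB ∩ (UB ∩ CB) = UB ∩ AB ∩ CB := by
    ext x; simp only [Finset.mem_inter]; tauto
  have e3 : CB ∩ (UB ∩ AB) = UB ∩ AB ∩ CB := by
    ext x; simp only [Finset.mem_inter]; tauto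
  rw [e1] at hBu; rw [e2] at hBa; rw [e3] at hBc
  exact latticeE3_rect_nonneg νB νQ hB0 hQ0 hB1 hQ1 w hw UB AB CB UQ AQ CQ hB3 hQ3 hBu hBa hBc hQac hQuc hQua

/-- **Unconditional instance: rectangle triples on `{0,1}⁴ × {0,1}⁴`.**  For every pair of FKG probability weights on the two
`{0,1}⁴` blocks and all up-set factors, the rectangle triple satisfies `C₃` (the factor instances are the tree theorem
`…SahiC3CubeFourFKG.sahiC3_cube_four_fkg`). [this work] -/
theorem latticeE3_rect_nonneg_cube_four_four (νB νQ : (Fin 4 → Bool) → ℝ) (hB0 : ∀ b, 0 ≤ νB b) (hQ0 : ∀ t, 0 ≤ νQ t)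
    (hBf : ∀ a b, νB a * νB b ≤ νB (a ⊓ b) * νB (a ⊔ b)) (hQf : ∀ a b, νQ a * νQ b ≤ νQ (a ⊓ b) * νQ (a ⊔ b))
    (hB1 : ∑ b, νB b = 1) (hQ1 : ∑ t, νQ t = 1) (w : (Fin 4 → Bool) × (Fin 4 → Bool) → ℝ)
    (hw : ∀ x, w x = νB x.1 * νQ x.2) (UB AB CB UQ AQ CQ : Finset (Fin 4 → Bool))
    (hUB : IsUpperSet (UB : Set (Fin 4 → Bool))) (hAB : IsUpperSet (AB : Set (Fin 4 → Bool)))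
    (hCB : IsUpperSet (CB : Set (Fin 4 → Bool))) (hUQ : IsUpperSet (UQ : Set (Fin 4 → Bool)))
    (hAQ : IsUpperSet (AQ : Set (Fin 4 → Bool))) (hCQ : IsUpperSet (CQ : Set (Fin 4 → Bool))) :
    0 ≤ latticeE3 w (UB ×ˢ UQ) (AB ×ˢ AQ) (CB ×ˢ CQ) :=
  latticeE3_rect_nonneg_of_fkg νB νQ hB0 hQ0 hBf hQf hB1 hQ1 w hw UB AB CB UQ AQ CQ hUB hAB hCB hUQ hAQ hCQ
    (SahiC3CubeFourFKG.sahiC3_cube_four_fkg (fun b => hB0 b) hBf UB AB CB hUB hAB hCB)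
    (SahiC3CubeFourFKG.sahiC3_cube_four_fkg (fun t => hQ0 t) hQf UQ AQ CQ hUQ hAQ hCQ)

end Summit.CriticalPhenomena.PercolationContinuityZ3.Theorems.SahiE3ProductClosure
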